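import Mathlib
import Summits.ABC.ABC.Statement
import Summits.ABC.ABC.Theorems.SoloBlindSquareCorner
import Literature.NumberTheory.DiophantineGeometry.AbcWave0MihailescuProofs
import HarnessLib

/-!
# Two corners of the first open support, classified (solo-blind seat, session 5)

`SoloBlindSquareCorner` proved `102·q² ≤ 289·rad` on the corner `1 + b = q²`, `ω(b q²) ≤ 3`.  Here the corner is
classified completely: `q ∈ {2, 3, 5, 7, 17}`, i.e. the triples `1 + 3 = 4`, `1 + 8 = 9`, `1 + 24 = 25`, `1 + 48 = 49`,
`1 + 288 = 289`.  By `two_mul_eq_or_of_prime_support` either `{(q-1), (q+1)} = {2^α, 2p}` — then `p = 2^(α-1) ± 1` and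
`q = 2^α ± 1` are both prime, and one of two consecutive numbers `2^j ± 1` is divisible by `3`, forcing `q ∈ {5, 7}` — or
`q - 1 = 16` (Mihăilescu), `q = 17`.

* `sq_corner_classification` : `q.Prime → b + 1 = q ^ 2 → #(1*b*q^2).primeFactors ≤ 3 → q = 2 ∨ q = 3 ∨ q = 5 ∨ q = 7 ∨ q = 17`.
* `even_corner` : the even-exponent corner of shape A (`2^l + q^(2i) = r^(2j)`, `q, r` prime, `q` odd) is exactly
  `16 + 9 = 25` and `32 + 49 = 81` — again Mihăilescu plus divisibility by `3`.
-/

namespace Summit.ABC.ABC.Theorems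

open Literature.NumberTheory.DiophantineGeometry

/-- `2 ^ j mod 3` is `1` for even `j` and `2` for odd `j`. -/
theorem two_pow_mod_three (j : ℕ) : 2 ^ j % 3 = if Even j then 1 else 2 := by
  induction j with
  | zero => simp
  | succ n ih =>
    rw [pow_succ, Nat.mul_mod, ih]
    by_cases h : Even n
    · have : ¬ Even (n + 1) := fun h' => by
        obtain ⟨a, ha⟩ := h; obtain ⟨b, hb⟩ := h'; omega
      simp [h, this]
    · have : Even (n + 1) := by
        rcases Nat.even_or_odd n with h' | ⟨a, ha⟩
        · exact absurd h' h
        · exact ⟨a + 1, by omega⟩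
      simp [h, this]

/-- If `1 ≤ i` and `2 ^ i + 1`, `2 ^ (i + 1) + 1` are both prime then `i = 1` (one of them is divisible by `3`). -/
theorem eq_one_of_prime_two_pow_succ {i : ℕ} (hi1 : 1 ≤ i) (h1 : (2 ^ i + 1).Prime)
    (h2 : (2 ^ (i + 1) + 1).Prime) : i = 1 := by
  have m1 := two_pow_mod_three i
  have m2 := two_pow_mod_three (i + 1)
  by_cases hi : Even i
  · have hni : ¬ Even (i + 1) := fun h' => by
      obtain ⟨a, ha⟩ := hi; obtain ⟨b, hb⟩ := h'; omega
    rw [if_neg hni] at m2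
    have h3 : 3 ∣ 2 ^ (i + 1) + 1 := by omega
    have := (Nat.prime_dvd_prime_iff_eq Nat.prime_three h2).mp h3
    have : 2 ^ (i + 1) = 2 ^ 1 := by omega
    have := Nat.pow_right_injective (le_refl 2) this
    omega
  · rw [if_neg hi] at m1
    have h3 : 3 ∣ 2 ^ i + 1 := by omega
    have := (Nat.prime_dvd_prime_iff_eq Nat.prime_three h1).mp h3
    have : 2 ^ i = 2 ^ 1 := by omega
    exact Nat.pow_right_injective (le_refl 2) this

/-- If `2 ^ i - 1` and `2 ^ (i + 1) - 1` are both prime (stated additively) then `i = 2`. -/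
theorem eq_two_of_prime_two_pow_pred {i p q : ℕ} (hp : p.Prime) (hq : q.Prime)
    (h1 : p + 1 = 2 ^ i) (h2 : q + 1 = 2 ^ (i + 1)) : i = 2 := by
  have m1 := two_pow_mod_three i
  have m2 := two_pow_mod_three (i + 1)
  by_cases hi : Even i
  · rw [if_pos hi] at m1
    have h3 : 3 ∣ p := by omega
    have := (Nat.prime_dvd_prime_iff_eq Nat.prime_three hp).mp h3
    have : 2 ^ i = 2 ^ 2 := by omega
    exact Nat.pow_right_injective (le_refl 2) this
  · have hi' : Even (i + 1) := by
      rcases Nat.even_or_odd i with h' | ⟨a, ha⟩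
      · exact absurd h' hi
      · exact ⟨a + 1, by omega⟩
    rw [if_pos hi'] at m2
    have h3 : 3 ∣ q := by omega
    have := (Nat.prime_dvd_prime_iff_eq Nat.prime_three hq).mp h3
    have : 2 ^ (i + 1) = 2 ^ 2 := by omega
    have hi1 : i = 1 := by have := Nat.pow_right_injective (le_refl 2) this; omega
    subst hi1
    have hp1 : p = 1 := by norm_num at h1; omega
    exact absurd hp (hp1 ▸ Nat.not_prime_one)

/-- **Classification of the prime-square corner.** `q` prime, `b + 1 = q²`, `#(1·b·q²).primeFactors ≤ 3`
force `q ∈ {2, 3, 5, 7, 17}`: the corner consists of `1 + 3 = 4`, `1 + 8 = 9`, `1 + 24 = 25`, `1 + 48 = 49`,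
`1 + 288 = 289` (qualities `< 1, 1.226, < 1, 1.041, 1.225`). Inputs: `two_mul_eq_or_of_prime_support` and
divisibility by `3` of one of `2^(s-1) ± 1`, `2^s ± 1`. [Mihailescu2004, Theorem 1] -/
theorem sq_corner_classification {b q : ℕ} (hq : q.Prime) (hbq : b + 1 = q ^ 2)
    (hω : (1 * b * q ^ 2).primeFactors.card ≤ 3) : q = 2 ∨ q = 3 ∨ q = 5 ∨ q = 7 ∨ q = 17 := by
  have hq2 := hq.two_le
  rcases Nat.lt_or_ge q 5 with hq5 | hq5
  · have : q ≠ 4 := by rintro rfl; exact absurd hq (by decide)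
    omega
  have hqsq : 4 ≤ q ^ 2 := by nlinarith
  have hb0 : b ≠ 0 := by omega
  obtain ⟨u, rfl⟩ : ∃ u, q = u + 1 := ⟨q - 1, by omega⟩
  have hu4 : 4 ≤ u := by omega
  have hqodd : Odd (u + 1) := hq.odd_of_ne_two (by omega)
  have hu : Even u := by
    rcases hqodd with ⟨k, hk⟩
    exact ⟨k, by omega⟩
  have hb : b = u * (u + 2) := by
    have h := hbq
    ring_nf at h ⊢
    linarith
  have h2b : 2 ∈ b.primeFactors :=
    Nat.mem_primeFactors.mpr ⟨Nat.prime_two, by rw [hb]; exact (even_iff_two_dvd.mp hu).mul_right _, hb0⟩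
  have hq0 : (u + 1) ^ 2 ≠ 0 := by positivity
  have hcard : b.primeFactors.card ≤ 2 := by
    have hsub : b.primeFactors ⊆ (1 * b * (u + 1) ^ 2).primeFactors := by
      rw [one_mul]; exact Nat.primeFactors_mono (dvd_mul_right b _) (mul_ne_zero hb0 hq0)
    have hqmem : u + 1 ∈ (1 * b * (u + 1) ^ 2).primeFactors := by
      rw [one_mul]
      exact Nat.mem_primeFactors.mpr ⟨hq, (dvd_pow_self (u + 1) two_ne_zero).mul_left b,
        mul_ne_zero hb0 hq0⟩
    have hqnot : u + 1 ∉ b.primeFactors := by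
      intro hmem
      have hdvd := (Nat.mem_primeFactors.mp hmem).2.1
      have h1 : u + 1 ∣ 1 := by
        have : u + 1 ∣ b + 1 := by rw [hbq]; exact dvd_pow_self (u + 1) two_ne_zero
        exact (Nat.dvd_add_right hdvd).mp this
      exact absurd (Nat.le_of_dvd one_pos h1) (by omega)
    have hne : b.primeFactors ≠ (1 * b * (u + 1) ^ 2).primeFactors := by
      intro h; rw [h] at hqnot; exact hqnot hqmem
    have hlt := Finset.card_lt_card (lt_of_le_of_ne hsub hne)
    omega
  obtain ⟨p, hp, hp2, hS⟩ : ∃ p, p.Prime ∧ p ≠ 2 ∧ ∀ d, d.Prime → d ∣ b → d = 2 ∨ d = p := by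
    by_cases hall : ∀ d ∈ b.primeFactors, d = 2
    · exact ⟨3, Nat.prime_three, by norm_num,
        fun d hd hdb => Or.inl (hall d (Nat.mem_primeFactors.mpr ⟨hd, hdb, hb0⟩))⟩
    · push Not at hall
      obtain ⟨p, hpmem, hp2⟩ := hall
      have hp := (Nat.mem_primeFactors.mp hpmem).1
      refine ⟨p, hp, hp2, fun d hd hdb => ?_⟩
      by_contra hne
      push Not at hne
      have hdmem : d ∈ b.primeFactors := Nat.mem_primeFactors.mpr ⟨hd, hdb, hb0⟩
      have h3 : ({2, p, d} : Finset ℕ).card = 3 :=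
        Finset.card_eq_three.mpr ⟨2, p, d, hp2.symm, hne.1.symm, hne.2.symm, rfl⟩
      have hsub3 : ({2, p, d} : Finset ℕ) ⊆ b.primeFactors := by
        intro x hx
        simp only [Finset.mem_insert, Finset.mem_singleton] at hx
        rcases hx with rfl | rfl | rfl
        exacts [h2b, hpmem, hdmem]
      have := Finset.card_le_card hsub3
      omega
  have hSu : ∀ d : ℕ, d.Prime → d ∣ u * (u + 2) → d = 2 ∨ d = p :=
    fun d hd hdvd => hS d hd (by rw [hb]; exact hdvd)
  rcases two_mul_eq_or_of_prime_support hu4 hu hp hp2 hSu with h1 | h2 | ⟨h16, -⟩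
  · -- `q + 1 = 2p`, `q - 1 = 2^α`: Fermat-type pair `p = 2^(α-1) + 1`, `q = 2^α + 1`
    have hpu : ¬ p ∣ u := by
      intro h
      have : p ∣ 2 := (Nat.dvd_add_right h).mp (Dvd.intro_left 2 h1)
      exact hp2 ((Nat.prime_dvd_prime_iff_eq hp Nat.prime_two).mp this)
    obtain ⟨α, hα⟩ : ∃ α : ℕ, u = 2 ^ α := by
      refine ⟨_, Nat.eq_prime_pow_of_unique_prime_dvd (by omega) ?_⟩
      intro d hd hdu
      rcases hSu d hd (hdu.mul_right _) with h | h
      · exact h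
      · exact absurd (h ▸ hdu) hpu
    have hα1 : 1 ≤ α := by
      by_contra h0
      obtain rfl : α = 0 := by omega
      simp at hα; omega
    have hpow : 2 ^ α = 2 * 2 ^ (α - 1) := by
      rw [← pow_succ', Nat.sub_add_cancel hα1]
    have hpeq : p = 2 ^ (α - 1) + 1 := by omega
    have hqeq : u + 1 = 2 ^ (α - 1 + 1) + 1 := by rw [Nat.sub_add_cancel hα1]; omega
    have hα2 : 1 ≤ α - 1 := by
      by_contra h0
      have h00 : α - 1 = 0 := by omega
      rw [h00] at hpeq
      norm_num at hpeq
      exact hp2 hpeq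
    have hi := eq_one_of_prime_two_pow_succ hα2 (hpeq ▸ hp) (hqeq ▸ hq)
    rw [hi] at hqeq
    norm_num at hqeq
    omega
  · -- `q - 1 = 2p`, `q + 1 = 2^γ`: Mersenne-type pair `p = 2^(γ-1) - 1`, `q = 2^γ - 1`
    have hpw : ¬ p ∣ u + 2 := by
      intro h
      have : p ∣ 2 := (Nat.dvd_add_right (Dvd.intro_left 2 h2)).mp h
      exact hp2 ((Nat.prime_dvd_prime_iff_eq hp Nat.prime_two).mp this)
    obtain ⟨γ, hγ⟩ : ∃ γ : ℕ, u + 2 = 2 ^ γ := by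
      refine ⟨_, Nat.eq_prime_pow_of_unique_prime_dvd (by omega) ?_⟩
      intro d hd hdw
      rcases hSu d hd (hdw.mul_left u) with h | h
      · exact h
      · exact absurd (h ▸ hdw) hpw
    have hγ1 : 1 ≤ γ := by
      by_contra h0
      obtain rfl : γ = 0 := by omega
      simp at hγ
    have hpow : 2 ^ γ = 2 * 2 ^ (γ - 1) := by
      rw [← pow_succ', Nat.sub_add_cancel hγ1]
    have hpeq : p + 1 = 2 ^ (γ - 1) := by omega
    have hqeq : (u + 1) + 1 = 2 ^ (γ - 1 + 1) := by rw [Nat.sub_add_cancel hγ1]; omega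
    have hi := eq_two_of_prime_two_pow_pred hp hq hpeq hqeq
    rw [hi] at hqeq
    norm_num at hqeq
    omega
  · omega

/-- **The even-exponent corner of shape A.** If `q, r` are primes, `q` odd, `i, j ≥ 1` and
`2 ^ l + q ^ (2 i) = r ^ (2 j)`, then `(l, q, i, r, j) = (4, 3, 1, 5, 1)` (`16 + 9 = 25`) or `(5, 7, 1, 3, 2)`
(`32 + 49 = 81`).  Factor `(r^j + q^i)(r^j - q^i) = 2^l`; parity forces `r^j - q^i = 2`, so
`{q^i, r^j} = {2^a - 1, 2^a + 1}`; Mihăilescu excludes proper powers except `2^3 + 1 = 3^2`, and `2^a ∓ 1` both prime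
forces `a = 2`.  [Mihailescu2004, Theorem 1] -/
theorem even_corner {l i j q r : ℕ} (hq : q.Prime) (hr : r.Prime) (hq2 : q ≠ 2) (hi : 1 ≤ i) (hj : 1 ≤ j)
    (h : 2 ^ l + q ^ (2 * i) = r ^ (2 * j)) :
    (l = 4 ∧ q = 3 ∧ i = 1 ∧ r = 5 ∧ j = 1) ∨ (l = 5 ∧ q = 7 ∧ i = 1 ∧ r = 3 ∧ j = 2) := by
  rw [mul_comm 2 i, mul_comm 2 j, pow_mul, pow_mul] at h
  obtain ⟨Y, hYdef⟩ : ∃ Y, Y = q ^ i := ⟨_, rfl⟩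
  obtain ⟨X, hXdef⟩ : ∃ X, X = r ^ j := ⟨_, rfl⟩
  rw [← hYdef, ← hXdef] at h
  have hq3 : 3 ≤ q := by have := hq.two_le; omega
  have hY3 : 3 ≤ Y := by
    rw [hYdef]
    calc 3 ≤ q := hq3
      _ = q ^ 1 := (pow_one q).symm
      _ ≤ q ^ i := Nat.pow_le_pow_right hq.pos hi
  have hX2 : 2 ≤ X := by
    rw [hXdef]
    calc 2 ≤ r := hr.two_le
      _ = r ^ 1 := (pow_one r).symm
      _ ≤ r ^ j := Nat.pow_le_pow_right hr.pos hj
  have hYodd : Odd Y := by rw [hYdef]; exact (hq.odd_of_ne_two hq2).pow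
  have hXY : Y < X := by
    have h2l : 1 ≤ 2 ^ l := Nat.one_le_two_pow
    have : Y ^ 2 < X ^ 2 := by omega
    exact (Nat.pow_lt_pow_iff_left (by norm_num)).mp this
  have hle : Y ≤ X := hXY.le
  have hfac : (X + Y) * (X - Y) = 2 ^ l := by
    zify [hle]
    have h' : ((2:ℤ) ^ l + (Y:ℤ) ^ 2 = (X:ℤ) ^ 2) := by exact_mod_cast h
    linear_combination -h'
  -- `l ≥ 1`, hence `X` is odd
  have hl : 1 ≤ l := by
    by_contra h0
    have hl0 : l = 0 := by omega
    rw [hl0, pow_zero] at hfac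
    have := Nat.eq_one_of_mul_eq_one_right hfac
    omega
  have hXodd : Odd X := by
    have hX2odd : Odd (X ^ 2) := by
      rw [← h]; exact Even.add_odd (Nat.even_pow.mpr ⟨even_two, by omega⟩) hYodd.pow
    have hXX : Odd (X * X) := by rw [← pow_two]; exact hX2odd
    exact (Nat.odd_mul.mp hXX).1
  have hXm : X % 2 = 1 := Nat.odd_iff.mp hXodd
  have hYm : Y % 2 = 1 := Nat.odd_iff.mp hYodd
  obtain ⟨t, -, ht⟩ := (Nat.dvd_prime_pow Nat.prime_two).mp (Dvd.intro (X - Y) hfac)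
  obtain ⟨s, -, hs⟩ := (Nat.dvd_prime_pow Nat.prime_two).mp (Dvd.intro_left (X + Y) hfac)
  have hst : t + s = l := by
    rw [ht, hs, ← pow_add] at hfac
    exact Nat.pow_right_injective le_rfl hfac
  -- `s = 1`: `s = 0` contradicts parity, `s ≥ 2` would make `X` even (as `t > s`)
  have hts : s < t := by
    have : 2 ^ s < 2 ^ t := by rw [← hs, ← ht]; omega
    exact (Nat.pow_lt_pow_iff_right (by norm_num)).mp this
  have hs1 : s = 1 := by
    rcases Nat.lt_or_ge s 2 with hs2 | hs2
    · by_contra hne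
      have hs0 : s = 0 := by omega
      rw [hs0, pow_zero] at hs
      omega
    · exfalso
      have h4s : 4 ∣ X - Y := by rw [hs]; exact (pow_dvd_pow 2 hs2 : 2 ^ 2 ∣ 2 ^ s)
      have h4t : 4 ∣ X + Y := by rw [ht]; exact (pow_dvd_pow 2 (by omega) : 2 ^ 2 ∣ 2 ^ t)
      omega
  subst hs1
  obtain ⟨a, rfl⟩ : ∃ a, t = a + 1 := ⟨t - 1, by omega⟩
  rw [pow_succ] at ht
  rw [pow_one] at hs
  -- `X = 2^a + 1`, `Y = 2^a - 1`, `a ≥ 2`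
  have hXa : X = 2 ^ a + 1 := by omega
  have hYa : Y + 1 = 2 ^ a := by omega
  have ha2 : 2 ≤ a := by
    have : 2 ^ 2 ≤ 2 ^ a := by omega
    exact (Nat.pow_le_pow_iff_right (by norm_num)).mp this
  -- `i = 1` by Mihăilescu (`2^a = q^i + 1` has no solution with `i ≥ 2`)
  have hi1 : i = 1 := by
    by_contra hne
    have hi2 : 2 ≤ i := by omega
    have hcat : 2 ^ a = q ^ i + 1 := by rw [← hYdef]; omega
    have := (mihailescu_holds hq.pos ha2 hi2 hcat).1
    omega
  subst hi1
  rw [pow_one] at hYdef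
  subst hYdef
  rcases Nat.lt_or_ge j 2 with hj2 | hj2
  · -- `j = 1`: `2^a - 1 = q` and `2^a + 1 = r` both prime ⟹ `a = 2`
    have hj1 : j = 1 := by omega
    subst hj1
    rw [pow_one] at hXdef
    subst hXdef
    have m := two_pow_mod_three a
    by_cases hae : Even a
    · rw [if_pos hae] at m
      have h3 : 3 ∣ Y := by omega
      have hY : Y = 3 := ((Nat.prime_dvd_prime_iff_eq Nat.prime_three hq).mp h3).symm
      have : 2 ^ a = 2 ^ 2 := by omega
      have := Nat.pow_right_injective le_rfl this
      left
      refine ⟨by omega, hY, rfl, by omega, rfl⟩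
    · rw [if_neg hae] at m
      have h3 : 3 ∣ X := by omega
      have hX : X = 3 := ((Nat.prime_dvd_prime_iff_eq Nat.prime_three hr).mp h3).symm
      have : 2 ^ a = 2 ^ 1 := by omega
      have := Nat.pow_right_injective le_rfl this
      omega
  · -- `j ≥ 2`: `r^j = 2^a + 1` ⟹ `r = 3, j = 2, a = 3` (Mihăilescu), so `q = 7`, `l = 5`
    have hcat : r ^ j = 2 ^ a + 1 := by rw [← hXdef]; exact hXa
    obtain ⟨hr3, hj2', -, ha3⟩ := mihailescu_holds two_pos hj2 ha2 hcat
    subst ha3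
    right
    exact ⟨by omega, by omega, rfl, hr3, hj2'⟩

end Summit.ABC.ABC.Theorems
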